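import Mathlib
import Summits.Ventures.HodgeRepro2.T5PadicProductOpenSubgroups

/-!
# T5PadicProductFiniteOrderCharacters — finite-order continuous characters of `ℤ_p^ι` have `p`-power order

Cell pub-hodge-repro2, Tier 5 support (seat p7; route/T5-CHECK-G-p7.md §3 S2 / S8). §G's S2 works on
`Γ⁻ ≅ ℤ_p^3` («Γ′ open of finite p-power index in Γ⁻ ≅ ℤ_p^3», «torsion-free Γ⁻» in (ψ1)–(ψ4)) and S8's
parenthesis reads «ν ∈ Ξ_𝔭 (finite order, p-power order since Γ_𝔭 ≅ ℤ_p, …)». T5PadicFiniteOrderCharacters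
(p400613) proved the `p`-power-order clause on `ℤ_p`; this file proves it on the PRODUCT `ℤ_p^ι`
(the anticyclotomic Galois group `Γ⁻ ≅ ℤ_p^3` of S2 before the projection to `Γ_𝔭`), on top of
T5PadicProductOpenSubgroups (p400764: every open subgroup of `ℤ_p^ι` contains `p^k ℤ_p^ι`):

* `kerAddSubgroup` / `isOpen_ker`: the kernel of a continuous finite-range character of any topological
  additive group is an open subgroup (the finitely many values `≠ 1` form a closed set);
* `exists_pow_eq_one_of_finite_range`: a continuous character `κ : ℤ_p^ι → R` with finitely many values
  satisfies `κ(x)^{p^k} = 1` for every `x`, for some `k` («p-power order»); `exists_pow_eq_one`: as an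
  element of the character group, `κ^{p^k} = 1`; `exists_orderOf_dvd_pow`: `orderOf (κ x) ∣ p^k`;
* `exists_ker_ge_span_pow`: the kernel contains `p^k ℤ_p^ι` — a finite-order character factors through
  `(ℤ/p^k)^ι`;
* `eq_zero_of_nsmul_eq_zero`: `ℤ_p^ι` is torsion-free («Γ⁻ torsion-free», the step of (ψ1)–(ψ4)).

Mathlib + own T5PadicProductOpenSubgroups only.
-/

namespace Summit.Ventures.HodgeRepro2.T5PadicProductFiniteOrderCharacters

open PadicInt Filter Topology
open Summit.Ventures.HodgeRepro2.T5PadicProductOpenSubgroups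

section General

variable {G : Type*} [AddGroup G] [TopologicalSpace G]
variable {R : Type*} [Monoid R] [TopologicalSpace R]

/-- The kernel `{x : κ x = 1}` of an additive character `κ : G → R`, as an additive subgroup. -/
def kerAddSubgroup (κ : AddChar G R) : AddSubgroup G where
  carrier := {x | κ x = 1}
  add_mem' := by
    intro a b ha hb
    simp only [Set.mem_setOf_eq] at ha hb ⊢
    rw [AddChar.map_add_eq_mul, ha, hb, one_mul]
  zero_mem' := AddChar.map_zero_eq_one κ
  neg_mem' := by
    intro a ha
    simp only [Set.mem_setOf_eq] at ha ⊢
    have h := κ.map_add_eq_mul (-a) a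
    rw [neg_add_cancel, AddChar.map_zero_eq_one, ha, mul_one] at h
    exact h.symm

omit [TopologicalSpace G] [TopologicalSpace R] in
/-- Membership in the kernel. -/
@[simp] theorem mem_kerAddSubgroup (κ : AddChar G R) (x : G) :
    x ∈ kerAddSubgroup κ ↔ κ x = 1 := Iff.rfl

/-- A continuous character with finitely many values has OPEN kernel: the finitely many values
`≠ 1` form a closed set (T1), and the kernel is the preimage of its complement. -/
theorem isOpen_ker [T1Space R] (κ : AddChar G R) (hκ : Continuous κ)
    (hfin : (Set.range κ).Finite) : IsOpen ((kerAddSubgroup κ : Set G)) := by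
  have hS : IsClosed (Set.range κ \ {1}) := (hfin.sdiff).isClosed
  have hpre : (kerAddSubgroup κ : Set G) = κ ⁻¹' (Set.range κ \ {1})ᶜ := by
    ext x
    simp only [SetLike.mem_coe, mem_kerAddSubgroup, Set.preimage_compl, Set.mem_compl_iff,
      Set.mem_preimage, Set.mem_sdiff, Set.mem_range, exists_apply_eq_apply, true_and,
      Set.mem_singleton_iff, not_not]
  rw [hpre]
  exact hS.isOpen_compl.preimage hκ

omit [TopologicalSpace G] [TopologicalSpace R] in
/-- `κ (n • x) = κ x ^ n`. -/
theorem map_nsmul (κ : AddChar G R) (n : ℕ) (x : G) : κ (n • x) = κ x ^ n :=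
  AddChar.map_nsmul_eq_pow κ n x

end General

section Product

variable {p : ℕ} [hp : Fact p.Prime] {ι : Type*} [Fintype ι]
variable {R : Type*} [Monoid R] [TopologicalSpace R]

omit [Fintype ι] [TopologicalSpace R] in
/-- `κ (p^k • x) = κ x ^ (p^k)` on `ℤ_p^ι` (the `ℤ_p`-scalar `p^k` acts as the natural number `p^k`). -/
theorem map_pow_smul (κ : AddChar (ι → ℤ_[p]) R) (k : ℕ) (x : ι → ℤ_[p]) :
    κ ((p : ℤ_[p]) ^ k • x) = κ x ^ (p ^ k) := by
  rw [← Nat.cast_pow, Nat.cast_smul_eq_nsmul, map_nsmul]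

/-- The kernel of a continuous finite-range character of `ℤ_p^ι` contains `p^k ℤ_p^ι` for some `k`. -/
theorem exists_forall_pow_smul_mem_ker [T1Space R] (κ : AddChar (ι → ℤ_[p]) R) (hκ : Continuous κ)
    (hfin : (Set.range κ).Finite) :
    ∃ k : ℕ, ∀ x : ι → ℤ_[p], (p : ℤ_[p]) ^ k • x ∈ kerAddSubgroup κ :=
  exists_pow_smul_mem_of_isOpen _ (isOpen_ker κ hκ hfin)

/-- S8 on `Γ⁻ ≅ ℤ_p^ι`, «p-power order»: a continuous character of `ℤ_p^ι` with finitely many values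
satisfies `κ(x)^{p^k} = 1` for every `x`, for some `k`. -/
theorem exists_pow_eq_one_of_finite_range [T1Space R] (κ : AddChar (ι → ℤ_[p]) R)
    (hκ : Continuous κ) (hfin : (Set.range κ).Finite) :
    ∃ k : ℕ, ∀ x : ι → ℤ_[p], κ x ^ (p ^ k) = 1 := by
  obtain ⟨k, hk⟩ := exists_forall_pow_smul_mem_ker κ hκ hfin
  refine ⟨k, fun x => ?_⟩
  rw [← map_pow_smul]
  exact hk x

/-- The order of every value of a continuous finite-range character of `ℤ_p^ι` divides `p^k`. -/
theorem exists_orderOf_dvd_pow [T1Space R] (κ : AddChar (ι → ℤ_[p]) R) (hκ : Continuous κ)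
    (hfin : (Set.range κ).Finite) :
    ∃ k : ℕ, ∀ x : ι → ℤ_[p], orderOf (κ x) ∣ p ^ k := by
  obtain ⟨k, hk⟩ := exists_pow_eq_one_of_finite_range κ hκ hfin
  exact ⟨k, fun x => orderOf_dvd_of_pow_eq_one (hk x)⟩

/-- As an element of the character group `AddChar (ℤ_p^ι) R` (pointwise product), a continuous
finite-range character has `p`-power order: `κ^{p^k} = 1`. -/
theorem exists_pow_eq_one {R : Type*} [CommMonoid R] [TopologicalSpace R] [T1Space R]
    (κ : AddChar (ι → ℤ_[p]) R) (hκ : Continuous κ) (hfin : (Set.range κ).Finite) :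
    ∃ k : ℕ, κ ^ (p ^ k) = 1 := by
  obtain ⟨k, hk⟩ := exists_pow_eq_one_of_finite_range κ hκ hfin
  refine ⟨k, AddChar.ext _ _ fun x => ?_⟩
  rw [AddChar.pow_apply, AddChar.one_apply]
  exact hk x

/-- The kernel contains the open subgroup `p^k ℤ_p^ι = Ideal.span {p^k}` in every coordinate: a
finite-order character of `ℤ_p^ι` factors through `(ℤ_p / p^k)^ι = (ℤ/p^k)^ι`. -/
theorem exists_ker_ge_span_pow [T1Space R] (κ : AddChar (ι → ℤ_[p]) R) (hκ : Continuous κ)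
    (hfin : (Set.range κ).Finite) :
    ∃ k : ℕ, ∀ x : ι → ℤ_[p], (∀ i, x i ∈ Ideal.span {(p : ℤ_[p]) ^ k}) → κ x = 1 := by
  obtain ⟨k, hk⟩ := exists_forall_pow_smul_mem_ker κ hκ hfin
  refine ⟨k, fun x hx => ?_⟩
  have hx' : ∀ i, ∃ y, x i = (p : ℤ_[p]) ^ k * y := fun i =>
    Ideal.mem_span_singleton'.mp (hx i) |>.imp fun y hy => by rw [← hy, mul_comm]
  choose y hy using hx'
  have : x = (p : ℤ_[p]) ^ k • y := by
    funext i
    rw [Pi.smul_apply, smul_eq_mul, hy i]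
  rw [this]
  exact hk y

omit [Fintype ι] in
/-- `ℤ_p^ι` is torsion-free («Γ⁻ torsion-free»): `n • x = 0` with `n ≠ 0` forces `x = 0`. -/
theorem eq_zero_of_nsmul_eq_zero {n : ℕ} (hn : n ≠ 0) {x : ι → ℤ_[p]} (h : n • x = 0) : x = 0 := by
  funext i
  have hi : n • x i = 0 := by
    have := congrFun h i
    simpa using this
  rw [← Nat.cast_smul_eq_nsmul ℤ_[p], smul_eq_mul] at hi
  rcases mul_eq_zero.mp hi with hn' | hx
  · exact absurd (Nat.cast_eq_zero.mp hn') hn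
  · exact hx

omit [Fintype ι] in
/-- A character-side corollary of torsion-freeness: an element `x ∈ ℤ_p^ι` with `2 • x = 0` is `0`
(the «g = c(g) = g⁻¹ ⇒ g² = 1 ⇒ g = 1» step of (ψ1), (ψ2), (ψ4) of S2, in the additive dialect of `Γ⁻`). -/
theorem eq_zero_of_two_nsmul_eq_zero {x : ι → ℤ_[p]} (h : 2 • x = 0) : x = 0 :=
  eq_zero_of_nsmul_eq_zero two_ne_zero h

end Product

end Summit.Ventures.HodgeRepro2.T5PadicProductFiniteOrderCharacters
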